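import Summits.HodgeConjecture.HodgeConjecture.Theorems.SignSymmetricPowersSignThreefoldPowersHodgeOffMeagre
import Literature.AlgebraicGeometry.HodgeTheory.HodgeGenericPointsGoodAnalyticCover
import Literature.AlgebraicGeometry.HodgeTheory.GriffithsHolomorphicHodgeSubbundlesQPChartHolds
import Summits.HodgeConjecture.HodgeConjecture.Theorems.CyclicUnitaryPowersCyclicSurfacePowersHodgeAlmostAll
import Literature.AlgebraicGeometry.HodgeTheory.HypersurfaceFamilyCoordinates
import Literature.AlgebraicGeometry.Motives.HodgeNumberFamilySemicontinuity
import Literature.Analysis.Calculus.RealAnalyticZeroSetAddHaar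
import Mathlib.MeasureTheory.Function.Jacobian
import HarnessLib

/-!
# Route `SignSymmetricPowers` — reading (a)-B ALMOST EVERYWHERE: the sign-deck clauses of crux K1-B and the Hodge conjecture on ALL
# self fibre powers hold for every smooth ι-even threefold `X = V(F) ⊂ ℙ⁴` whose coefficient vector lies off ONE subset of `ℂ^{M_ι}`
# that is both MEAGRE and LEBESGUE-NULL — UNCONDITIONALLY (no named fact; NO Cattani–Deligne–Kaplan)

Support file for crux K1-B `VeryGeneralSignCommutatorsInHg` (stmt-HodgeConjecture-19716; `--supports … --as helper`, nothing here closes an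
item).  Prover seat `hodge-nonav-19716-p2` (g12, cell `hodge-nonav`), programme «OFF-MEAGRE-B» (route owner hodge-nonav-p3 g35, STATUS
2026-08-29T06:06:24Z: «ONE meagre + Lebesgue-null exceptional set»), the route-B twin ONE DIMENSION UP of route A's
`CyclicUnitaryPowersCyclicSurfacePowersHodgeAlmostAll.cyclicSurfacePowersHodge_ae` (prover-Ax g13).

`SignSymmetricPowersSignThreefoldPowersHodgeOffMeagre` ∕ `…OffMeagreHolds` (this seat) give the MEAGRE exceptional set from the abstract
form of Griffiths' theorem (`Griffiths1968_holomorphicHodgeSubbundlesQP`, chart `ψ` an opaque homeomorphism ⇒ only topological smallness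
transfers).  A meagre set can have full measure; the measure-zero sharpening needs the Hodge loci read in charts that are `C¹`-related to
the algebraic structure.  The cell's programme GRIFFITHS-HOLOMORPHY exported exactly that: `griffiths1968_holomorphicHodgeSubbundlesQP_chart_holds`
(prover-Bx g18 p703779, on 20241-p1 g20's `exists_hodgeFrames_of_chartBallFrames_chart` p703271) pins `ψ` to the algebraic chart
`extChartAt 𝓘(ℂ, ℂᵈ) t₁` of `chartedSpaceOfCharts (ComplexPoints.algebraicChart S d)`.  THE CHAIN:

* §0 `differentiableOn_coeffChart_comp_algebraicChart_symm_baseM` — GAGA: the coefficient chart `t ↦ (t(a_m))_{m ∈ M}` of `S_M(ℂ)` is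
  holomorphic in every algebraic chart (`mdifferentiable_affineCoords_map_comp` for `S_M → U → 𝔸^{DegIndex n d}`); `volume_setOf_eval_eq_zero`
  — the zero set of a non-zero polynomial on `ℂ^ι` is Lebesgue-null (Mityagin, `addHaar_zeroSet_eq_zero_of_analyticOnNhd_complex_univ`).
* §1 `exists_nullMeagre_identityComponent_le_mumfordTate_familyM` — for `familyM ℂ n d M` (`d ≥ 1`, `S_M(ℂ) ≠ ∅`, any degree `k`): a MEAGRE
  `MS ⊆ S_M(ℂ)` whose coefficient-chart image is `volume`-NULL, off which `(Γ_t^Zar)⁰ ⊆ MT(Hᵏ(𝒴_t))` — the Good-chart countable analytic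
  cover `exists_countable_goodAnalyticCover_not_isHodgeGenericPoint` (this seat, `HodgeGenericPointsGoodAnalyticCover`) fed by the PINNED
  Griffiths theorem with `Good ψ` := «`ψ` is `ComplexPoints.algebraicChart S_M m t₀` for some `t₀`» (route A's predicate), each cover set
  mapped by the coefficient chart into a null set (route A's `volume_image_zeroSet_eq_zero` + §0), and Deligne (i) PROVED
  (`deligne_finiteIndex_monodromy_le_mumfordTateGroup_of_isQuasiProjectiveOver`).
* §2 `exists_signDeck_comm_ae` — analytic K1-B almost everywhere (the crux's `let`-block verbatim; `∃ M, IsMeagre M ∧ volume M = 0 ∧ …`):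
  the pointwise kernel `SignSymmetricPowersPencilKernel.signModel_of_identityComponent_le_mumfordTate` (prover-Ax g15) at the PROVED hN′
  `WeightedPencil.symmetricA3NonCommutation_mono_holds`, §1, the coefficient chart (embedding: meagre image; restricted discriminant
  `D_{M_ι} ≠ 0`: `V(D_{M_ι})` closed nowhere dense and null) and model transfer along `X ≅ X_F`.
* §3 `signThreefoldPowersHodge_ae` — the leaf almost everywhere: `HodgeConjectureFor (3(k+1)) Y` for every self fibre power, NO hypothesis,
  axioms standard (§2 + K2-B `SignSymmetricPowersClose.powersHodgeOfSignCommutators`); `ae_not_mem_exceptional`.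

HONEST FRAMING: this is the Hodge conjecture for all powers of Lebesgue-almost-every (and comeagre-many) ι-even threefold of every even degree
`d ≥ 4`; the exceptional set is NOT shown to lie in a countable union of proper Zariski-closed subsets (that is Cattani–Deligne–Kaplan, print
input stmt-HodgeConjecture-23152), so items 19716 ∕ 19715 stay OPEN; rung F-H1 is not moved by this file; nothing here says HC ∕ HC_CM ∕
HC_AV is proved.

## References
* [Deligne1972WeilK3] P. Deligne, La conjecture de Weil pour les surfaces K3, Invent. Math. 15 (1972), Prop. 7.5.
* [Andre1992] Y. André, Mumford–Tate groups of mixed Hodge structures …, Compositio Math. 82 (1992), §4 Lemma 4, §5 Thm. 1.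
* [VoisinHodgeII2003] C. Voisin, Hodge Theory and Complex Algebraic Geometry II, CUP 2003, §5.3.1 Lemma 5.13, §6.1.3, §6.2.1.
* [VoisinHodgeI2002] C. Voisin, Hodge Theory and Complex Algebraic Geometry I, §10.2.1 Thm. 10.3.
* [Griffiths1968PeriodsII] P. Griffiths, Periods of integrals on algebraic manifolds II, Amer. J. Math. 90 (1968), Thm. 1.1.
* [CarlsonMullerStachPeters2017] J. Carlson, S. Müller-Stach, C. Peters, Period Mappings and Period Domains, Def. 15.3.5, L.-D. 15.3.7.
* [SerreGAGA1956] J.-P. Serre, Géométrie algébrique et géométrie analytique, §2 n°5 Prop. 2.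
* [Mityagin2015] B. Mityagin, The zero set of a real analytic function, arXiv:1512.07276, Prop. 1.
-/

noncomputable section

set_option linter.dupNamespace false
set_option maxHeartbeats 800000

namespace Summit.HodgeConjecture.HodgeConjecture.Theorems.SignSymmetricPowersSignThreefoldPowersHodgeAlmostAll

open scoped Manifold ContDiff Topology TensorProduct
open MeasureTheory Set Module
open CategoryTheory CategoryTheory.Limits AlgebraicGeometry
open _root_.Topology _root_.Filter
open Literature.NumberTheory.Transcendental Literature.AlgebraicGeometry.Motives Literature.AlgebraicGeometry.HodgeTheory
open Literature.AlgebraicGeometry.HodgeTheory.BettiUniverse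
open Literature.AlgebraicGeometry.Motives.UniversalHypersurface Literature.AlgebraicGeometry.HodgeTheory.UniversalHypersurface
open Literature.AlgebraicTopology.SingularHomology
open Literature.AlgebraicGeometry.HodgeTheory.MonomialPencil
open Literature.AlgebraicGeometry.FundamentalGroup
open Literature.AlgebraicGeometry.Motives.SmoothHypersurface (IsNonsingularForm)
open Summit.HodgeConjecture.HodgeConjecture.Theorems.SignSymmetricPowersConfluenceLinkG (isSupportedOn_of_coeff_odd_eq_zero)
open Summit.HodgeConjecture.HodgeConjecture.Theorems.SignSymmetricPowersFourFactsGeometricGenus (signDeckHodge_of_genusBound)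
open Summit.HodgeConjecture.HodgeConjecture.Theorems.SmoothHypersurfaceGeometricGenus (stub_genusBoundThreefold)

/-! ### §0 GAGA: the coefficient chart of `S_M(ℂ)` is holomorphic in algebraic charts; polynomial zero sets are null -/

/-- **The coefficient chart of `S_M(ℂ)` is holomorphic in every algebraic chart** (Serre, GAGA §2 n°5: regular functions are
holomorphic): for every point `t₁` of `S_M(ℂ)`, `z ↦ (coeff_m F_{(algebraicChart S_M m t₁)⁻¹ z})_{m ∈ M}` is `ℂ`-differentiable on the
target of the algebraic chart at `t₁` (each coefficient is an affine coordinate of `S_M → U → 𝔸^{DegIndex n d}`,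
`mdifferentiable_affineCoords_map_comp` on the analytification `id : S_M(ℂ) → S_M(ℂ)`). [cite: SerreGAGA1956, §2 n°5 Prop. 2] -/
theorem differentiableOn_coeffChart_comp_algebraicChart_symm_baseM (n d : ℕ) (M : Set (DegIndex n d)) (m : ℕ)
    [LocallyOfFiniteType (baseM ℂ n d M).hom] [SmoothOfRelativeDimension m (baseM ℂ n d M).hom]
    (t₁ : ComplexPoints (baseM ℂ n d M)) :
    DifferentiableOn ℂ (fun z ↦
        (coeffVector ℂ n d (AlgPoints.map (toBase ℂ n d M) ((ComplexPoints.algebraicChart (baseM ℂ n d M) m t₁).symm z))) ∘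
          (Subtype.val : M → DegIndex n d))
      (ComplexPoints.algebraicChart (baseM ℂ n d M) m t₁).target := by
  letI cs : ChartedSpace (Fin m → ℂ) (ComplexPoints (baseM ℂ n d M)) :=
    chartedSpaceOfCharts (ComplexPoints.algebraicChart (baseM ℂ n d M) m)
      (ComplexPoints.mem_algebraicChart_source _ m)
  haveI : IsManifold 𝓘(ℂ, Fin m → ℂ) ω (ComplexPoints (baseM ℂ n d M)) := isManifold_algebraicChart _ m
  refine differentiableOn_pi.2 fun e ↦ ?_
  -- the coefficient as an affine coordinate of `S_M → U → 𝔸`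
  set g := toBase ℂ n d M ≫ baseToAffineSpace ℂ n d with hg
  have hfun : ∀ t : ComplexPoints (baseM ℂ n d M),
      ((coeffVector ℂ n d (AlgPoints.map (toBase ℂ n d M) t)) ∘ (Subtype.val : M → DegIndex n d)) e =
        AlgPoints.affineCoords (AlgPoints.map g t) e.1 := by
    intro t
    change coeffVector ℂ n d (AlgPoints.map (toBase ℂ n d M) t) e.1 = _
    rw [hg, AlgPoints.map_comp_apply, coeffVector_eq_comp]
    rfl
  -- holomorphy on the manifold `S_M(ℂ)` (GAGA), read in the chart at `t₁`
  have hmd : MDifferentiable 𝓘(ℂ, Fin m → ℂ) 𝓘(ℂ, ℂ)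
      (fun t : ComplexPoints (baseM ℂ n d M) ↦ AlgPoints.affineCoords (AlgPoints.map g (id t)) e.1) :=
    mdifferentiable_affineCoords_map_comp g (isAnalytification_algebraicChart (X := baseM ℂ n d M) (e := m)) e.1
  intro z hz
  set c := ComplexPoints.algebraicChart (baseM ℂ n d M) m t₁ with hc
  have hx' : c.symm z ∈ (chartAt (Fin m → ℂ) t₁).source := c.map_target hz
  have h := (mdifferentiableAt_iff_of_mem_source (I := 𝓘(ℂ, Fin m → ℂ)) (I' := 𝓘(ℂ, ℂ))
    (x := t₁) (y := AlgPoints.affineCoords (AlgPoints.map g (id (c.symm z))) e.1) hx'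
    (mem_chart_source ℂ _)).1 (hmd (c.symm z))
  obtain ⟨-, hd⟩ := h
  rw [extChartAt_self_eq, modelWithCornersSelf_coe, Function.id_comp, ModelWithCorners.range_eq_univ] at hd
  have hz' : extChartAt 𝓘(ℂ, Fin m → ℂ) t₁ (c.symm z) = z := by
    rw [extChartAt_coe, modelWithCornersSelf_coe, Function.id_comp]
    exact c.right_inv hz
  rw [hz'] at hd
  have hd' : DifferentiableAt ℂ (fun w ↦ AlgPoints.affineCoords (AlgPoints.map g (c.symm w)) e.1) z := by
    have := hd.differentiableAt Filter.univ_mem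
    refine this.congr_of_eventuallyEq (Filter.Eventually.of_forall fun w ↦ ?_)
    simp only [Function.comp_apply, id_eq, extChartAt_coe_symm, modelWithCornersSelf_coe_symm, Function.comp_id]
    rfl
  have heq : (fun w ↦ ((coeffVector ℂ n d (AlgPoints.map (toBase ℂ n d M) (c.symm w))) ∘
      (Subtype.val : M → DegIndex n d)) e) = fun w ↦ AlgPoints.affineCoords (AlgPoints.map g (c.symm w)) e.1 :=
    funext fun w ↦ hfun _
  rw [heq]
  exact hd'.differentiableWithinAt

/-- **The zero set of a non-zero polynomial on `ℂ^ι` (`ι` finite) is Lebesgue-null**: a polynomial function is (real-)analytic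
(`AnalyticOnNhd.eval_mvPolynomial`), and the zero set of a non-trivial real-analytic function is null for every additive Haar
measure (`addHaar_zeroSet_eq_zero_of_analyticOnNhd_complex_univ`). [cite: Mityagin2015, Proposition 1] -/
theorem volume_setOf_eval_eq_zero {ι : Type} [Fintype ι] {D : MvPolynomial ι ℂ} (hD : D ≠ 0) :
    volume {a : ι → ℂ | MvPolynomial.eval a D = 0} = 0 := by
  have hne : ∃ a : ι → ℂ, MvPolynomial.eval a D ≠ 0 := by
    by_contra hcon
    push Not at hcon
    exact hD (MvPolynomial.funext fun x => by rw [hcon x, map_zero])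
  exact Literature.Analysis.Calculus.addHaar_zeroSet_eq_zero_of_analyticOnNhd_complex_univ volume
    ((AnalyticOnNhd.eval_mvPolynomial D).restrictScalars (𝕜 := ℝ)) hne

/-! ### §1 Off a MEAGRE and coefficient-NULL subset of `S_M(ℂ)` the algebraic monodromy group of `familyM` lies in `MT` -/

/-- **Deligne's «very general», null AND meagre form, for the `M`-supported family — UNCONDITIONAL** (the analytic input is the PINNED form
of Griffiths' theorem `griffiths1968_holomorphicHodgeSubbundlesQP_chart_holds`, programme GRIFFITHS-HOLOMORPHY: holomorphic frames of the Hodge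
bundles in ALGEBRAIC charts of the base).  For `d ≥ 1`, `S_M(ℂ) ≠ ∅`,
Hodge-symmetric models `A`: there is `MS ⊆ S_M(ℂ)`, MEAGRE, whose image under the coefficient chart `χ : S_M(ℂ) ↪ ℂ^M` has `volume`
ZERO, such that at every `t ∉ MS` the identity component `(Γ_t^Zar)⁰` of the monodromy group of `π_M` lies in `MT(Hᵏ(𝒴_t))`.  `MS` is
the union of the countably many local analytic hypersurfaces of `exists_countable_goodAnalyticCover_not_isHodgeGenericPoint` (each
nowhere dense; each mapped by `χ` into a null set: `volume_image_zeroSet_eq_zero` with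
`differentiableOn_coeffChart_comp_algebraicChart_symm_baseM`); off it every point is Hodge generic, and Deligne (i) is PROVED
(`deligne_finiteIndex_monodromy_le_mumfordTateGroup_of_isQuasiProjectiveOver`). [cite: Deligne1972WeilK3, Prop. 7.5]
[cite: VoisinHodgeII2003, §5.3.1 Lemma 5.13] [cite: CarlsonMullerStachPeters2017, Lemma–Definition 15.3.7] [cite: SerreGAGA1956, §2 n°5 Prop. 2] -/
theorem exists_nullMeagre_identityComponent_le_mumfordTate_familyM
    [HodgeTensorFacts.{0, 0}] {n d : ℕ} (hd : 1 ≤ d) (M : Set (DegIndex n d)) [DecidablePred (· ∈ M)] (k : ℕ)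
    (hu : IsSmoothProjectiveFamily (familyM ℂ n d M) n)
    (hU : IsCohomologicallyLocallyTrivialOn (familyM ℂ n d M) (univ : Set (ComplexPoints (baseM ℂ n d M))))
    (A : ∀ t : ComplexPoints (baseM ℂ n d M), HodgeModel n (fiberOver (familyM ℂ n d M) t)) (hA : ∀ t, (A t).IsHodgeSymmetric)
    [hfin : ∀ t : ComplexPoints (baseM ℂ n d M), Module.Finite ℚ (bettiCohomology (fiberOver (familyM ℂ n d M) t) k)]
    (hne : Nonempty (ComplexPoints (baseM ℂ n d M))) :
    ∃ MS : Set (ComplexPoints (baseM ℂ n d M)), IsMeagre MS ∧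
      volume ((fun t : ComplexPoints (baseM ℂ n d M) =>
        (coeffVector ℂ n d (AlgPoints.map (toBase ℂ n d M) t)) ∘ (Subtype.val : M → DegIndex n d)) '' MS) = 0 ∧
      ∀ t : ComplexPoints (baseM ℂ n d M), t ∉ MS →
        glIdentityComponent (ratMonodromyGroup (familyM ℂ n d M) k hU ⟨t, mem_univ _⟩) ⊆
          (((A t).hodgeStructure (hu.isSmoothProjective t) (hA t) k).mumfordTateGroup :
            Set (bettiCohomology (fiberOver (familyM ℂ n d M) t) k ≃ₗ[ℚ] bettiCohomology (fiberOver (familyM ℂ n d M) t) k)) := by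
  classical
  haveI := smoothOfRelativeDimension_baseM_hom ℂ n d M
  haveI : LocallyOfFiniteType (baseM ℂ n d M).hom := locallyOfFiniteType_baseM_hom ℂ n d M
  have hirr : IrreducibleSpace (baseM ℂ n d M).left := irreducibleSpace_baseM_left ℂ n d M ⟨hne.some.pt⟩
  have hS : IsQuasiProjectiveOver (baseM ℂ n d M) := isQuasiProjectiveOver_baseM n d M
  have h𝒳 : IsQuasiProjectiveOver (totalM ℂ n d M) := isQuasiProjectiveOver_totalM ℂ n d M (by omega)
  have hSs : Smooth (baseM ℂ n d M).hom := smooth_baseM_hom ℂ n d M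
  -- notation
  set S := baseM ℂ n d M with hSdef
  set m : ℕ := 0 + Nat.card M with hmdef
  let Good : OpenPartialHomeomorph (Set.univ : Set (ComplexPoints S)) (Fin m → ℂ) → Prop := fun ψ ↦
    ∃ t₀ : ComplexPoints S, (∀ t, (ψ t : Fin m → ℂ) = ComplexPoints.algebraicChart S m t₀ t.1) ∧
      (∀ t, t ∈ ψ.source ↔ t.1 ∈ (ComplexPoints.algebraicChart S m t₀).source) ∧
      (∀ z, ((ψ.symm z : (Set.univ : Set (ComplexPoints S))) : ComplexPoints S) =
        (ComplexPoints.algebraicChart S m t₀).symm z)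
  -- the countable analytic cover of the non-generic points, in Good charts
  obtain ⟨𝒞, h𝒞c, h𝒞s, hcov⟩ := exists_countable_goodAnalyticCover_not_isHodgeGenericPoint (familyM ℂ n d M) n k m hu hS
    hU A hA Good (fun s t₁ N hN ↦ by
      -- the PINNED form of Griffiths' theorem (programme GRIFFITHS-HOLOMORPHY, prover-Bx g18 p703779)
      letI cs : ChartedSpace (Fin m → ℂ) (ComplexPoints S) :=
        chartedSpaceOfCharts (ComplexPoints.algebraicChart S m) (ComplexPoints.mem_algebraicChart_source S m)
      obtain ⟨W, hWo, ht₁W, hWN, hWpc, ψ, hWψ, hψ₁, hψ₂, hψ₃, hfr⟩ :=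
        griffiths1968_holomorphicHodgeSubbundlesQP_chart_holds (familyM ℂ n d M) n k m hu hS h𝒳 hU A hA s t₁ N hN
      refine ⟨W, hWo, ht₁W, hWN, hWpc, ψ, ⟨t₁.1, fun t ↦ ?_, fun t ↦ ?_, fun z ↦ ?_⟩, hWψ, hfr⟩
      · rw [hψ₁ t, extChartAt_coe, modelWithCornersSelf_coe, Function.id_comp]
        rfl
      · rw [hψ₃ t, extChartAt_source]
        exact Iff.rfl
      · rw [hψ₂ z, extChartAt_coe_symm, modelWithCornersSelf_coe_symm, Function.comp_id]
        rfl)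
  -- the coefficient chart
  let χ : ComplexPoints S → (M → ℂ) := fun t =>
    (coeffVector ℂ n d (AlgPoints.map (toBase ℂ n d M) t)) ∘ (Subtype.val : M → DegIndex n d)
  have hχ : Topology.IsEmbedding χ := SignSymmetricPowersMeridianChart.isEmbedding_coeffChart n d M
  refine ⟨Subtype.val '' ⋃₀ 𝒞, ?_, ?_, ?_⟩
  · -- meagre
    refine Topology.IsInducing.subtypeVal.isMeagre_image ?_
    rw [isMeagre_iff_countable_union_isNowhereDense]
    exact ⟨𝒞, fun Z hZ ↦ (h𝒞s Z hZ).2, h𝒞c, subset_rfl⟩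
  · -- null image under the coefficient chart
    have himage : χ '' (Subtype.val '' ⋃₀ 𝒞) = ⋃ Z ∈ 𝒞, χ '' (Subtype.val '' Z) := by
      rw [Set.sUnion_eq_biUnion, Set.image_iUnion₂, Set.image_iUnion₂]
    rw [himage]
    refine (measure_biUnion_null_iff h𝒞c).2 fun Z hZ ↦ ?_
    obtain ⟨⟨W', ψ, g, ⟨t₀, hψa, hψs, hψy⟩, hW'o, hW'pc, hW'ψ, hg, hne', rfl⟩, -⟩ := h𝒞s Z hZ
    set c := ComplexPoints.algebraicChart S m t₀ with hc
    -- the image lies in `F '' {z ∈ ψ(W') | g z = 0}`, `F = χ ∘ c⁻¹`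
    have hsub : χ '' (Subtype.val '' {t | t ∈ W' ∧ g (ψ t) = 0}) ⊆
        (fun z ↦ χ (c.symm z)) '' {z ∈ ψ '' W' | g z = 0} := by
      rintro _ ⟨_, ⟨t, ht, rfl⟩, rfl⟩
      refine ⟨ψ t, ⟨Set.mem_image_of_mem _ ht.1, ht.2⟩, ?_⟩
      change χ (c.symm (ψ t)) = χ t.1
      rw [← hψy, ψ.left_inv (hW'ψ ht.1)]
    refine measure_mono_null hsub ?_
    have hUo : IsOpen (ψ '' W') := ψ.isOpen_image_of_subset_source hW'o hW'ψ
    have hUc : IsConnected (ψ '' W') := (hW'pc.image' (ψ.continuousOn.mono hW'ψ)).isConnected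
    have hUT : ψ '' W' ⊆ c.target := by
      rintro _ ⟨t, ht, rfl⟩
      rw [hψa t]
      exact c.map_source ((hψs t).1 (hW'ψ ht))
    have hne'' : ∃ z ∈ ψ '' W', g z ≠ 0 := by
      obtain ⟨t', ht', hne'⟩ := hne'
      exact ⟨ψ t', Set.mem_image_of_mem _ ht', hne'⟩
    exact CyclicUnitaryPowersGenericCyclicSurfacePowersHodge.volume_image_zeroSet_eq_zero (T := M)
      (by rw [hmdef, Nat.card_eq_fintype_card, zero_add]) hUo hUc (fun z hz ↦ (hg z hz).restrictScalars) hne''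
      (((differentiableOn_coeffChart_comp_algebraicChart_symm_baseM n d M m t₀).mono hUT).restrictScalars ℝ)
  · -- off `MS`: Hodge generic, hence `(Γ^Zar)⁰ ⊆ MT` (Deligne (i), PROVED)
    intro t ht
    have hgen : IsHodgeGenericPoint (familyM ℂ n d M) k hU hu A hA ⟨t, mem_univ _⟩ := by
      by_contra hng
      exact ht ⟨⟨t, mem_univ _⟩, hcov hng, rfl⟩
    exact (deligne_finiteIndex_monodromy_le_mumfordTateGroup_of_isQuasiProjectiveOver (familyM ℂ n d M) n k hu h𝒳 hS hSs
      hirr hU A hA ⟨t, mem_univ _⟩ hgen).2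

/-! ### §2 Analytic K1-B — almost everywhere, unconditional -/

/-- **Analytic K1-B, almost everywhere, UNCONDITIONALLY**: for every even `d ≥ 4` a set `M ⊆ ℂ^{M_ι}` of ι-even coefficient vectors,
MEAGRE AND LEBESGUE-NULL, such that every ι-even homogeneous `f` of degree `d` with `M_ι`-coefficient vector off `M` and every smooth
projective threefold `X ⊂ ℙ⁴` cut out by `f` carry `σ : X ⟶ X` with the clauses `Deck ∧ Comm` of crux K1-B `VeryGeneralSignCommutatorsInHg`
(its `let`-block VERBATIM; the statement of `exists_signDeck_comm_offMeagre` with the extra conjunct `volume M = 0`).  `M = χ(MS) ∪ V(D_{M_ι})`: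
`MS` from §1 (pinned Griffiths ⇒ Hodge loci are analytic hypersurfaces in algebraic charts ⇒ null images under the coefficient chart, GAGA),
`V(D_{M_ι})` the zero set of the non-zero restricted discriminant (null: Mityagin).  «Very general» read as «off a null AND meagre set»;
item 19716 (Zariski-very-general, ⟸ Cattani–Deligne–Kaplan) stays OPEN; HC not proved. [cite: Deligne1972WeilK3, Prop. 7.5]
[cite: Andre1992, §4 Lemma 4 and §5 Thm. 1] [cite: VoisinHodgeII2003, §5.3.1 Lemma 5.13 and §6.2.1] [cite: Griffiths1968PeriodsII, Thm. 1.1]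
[cite: CarlsonMullerStachPeters2017, Lemma–Definition 15.3.7] [cite: Mityagin2015, Proposition 1] -/
theorem exists_signDeck_comm_ae :
    open Literature.AlgebraicGeometry.Motives Literature.AlgebraicGeometry.HodgeTheory Literature.AlgebraicGeometry.HodgeTheory.BettiUniverse CategoryTheory.Limits in let pmul2 : List (ℕ × ℕ) → List (ℕ × ℕ) → List (ℕ × ℕ) := fun a b => (List.range (a.length + b.length - 1)).map fun k => (((List.range (k + 1)).map fun i => (a.getD i (0, 0)).1 * (b.getD (k - i) (0, 0)).1 + (a.getD i (0, 0)).2 * (b.getD (k - i) (0, 0)).2).sum, ((List.range (k + 1)).map fun i => (a.getD i (0, 0)).1 * (b.getD (k - i) (0, 0)).2 + (a.getD i (0, 0)).2 * (b.getD (k - i) (0, 0)).1).sum); let fac : ℕ → Bool → List (ℕ × ℕ) := fun d odd => (List.range (d - 1)).map fun k => if odd ∧ ¬ Even k then (0, 1) else (1, 0); let shn : ℕ → ℕ → ℕ → ℕ := fun d j q => if (q + 1) * d < 5 then 0 else if j = 0 then (([fac d true, fac d false, fac d false, fac d false].foldl pmul2 (fac d true)).getD ((q + 1) * d - 5) (0,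 0)).1 else (([fac d true, fac d false, fac d false, fac d false].foldl pmul2 (fac d true)).getD ((q + 1) * d - 5) (0, 0)).2; let Deck : (d : ℕ) → (X : SchemeOver ℂ) → IsSmoothProjective 3 X → (X ⟶ X) → Prop := fun d X hX σ => pull σ 3 ^ 2 = 1 ∧ (∀ x y, tr hX (3 + 3) (cup X 3 3 (pull σ 3 x) (pull σ 3 y)) = tr hX (3 + 3) (cup X 3 3 x y)) ∧ ∀ j q : ℕ, j < 2 → q ≤ 3 → Module.finrank ℂ ↥(Module.End.eigenspace ((pull σ 3).baseChange ℂ) ((-1 : ℂ) ^ j) ⊓ (hodge exists_isReal_hodgeModel_holds hX 3).piece ((3 : ℤ) - q) q) = shn d j q; let Cen : (X : SchemeOver ℂ) → IsSmoothProjective 3 X → (X ⟶ X) → (bettiCohomology X 3 ≃ₗ[ℚ] bettiCohomology X 3) → Prop := fun X hX σ g => (∀ x, g (pull σ 3 x) = pull σ 3 (g x)) ∧ ∀ x y, tr hX (3 + 3) (cup X 3 3 (g x) (g y)) = tr hX (3 + 3) (cup X 3 3 x y); let Comm : (X : SchemeOver ℂ) → IsSmoothProjective 3 X → (X ⟶ X)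 → Prop := fun X hX σ => haveI := finite hX 3; haveI : HodgeTensorFacts.{0, 0} := hodgeTensorFacts_holds; ∀ g h : bettiCohomology X 3 ≃ₗ[ℚ] bettiCohomology X 3, Cen X hX σ g → Cen X hX σ h → g * h * g⁻¹ * h⁻¹ ∈ (hodge exists_isReal_hodgeModel_holds hX 3).hodgeGroup; ∀ ⦃d : ℕ⦄, Even d → 4 ≤ d → ∃ Mb : Set ({m : DegIndex 3 d | Even (m.1 0 + m.1 1)} → ℂ), IsMeagre Mb ∧ MeasureTheory.volume Mb = 0 ∧ ∀ f : MvPolynomial (Fin 5) ℂ, f.IsHomogeneous d → (∀ e : Fin 5 →₀ ℕ, ¬ Even (e 0 + e 1) → f.coeff e = 0) → (fun m : {m : DegIndex 3 d | Even (m.1 0 + m.1 1)} => f.coeff m.1.1) ∉ Mb → ∀ ⦃X : SchemeOver ℂ⦄ (hX : IsSmoothProjective 3 X), IsHypersurfaceCutOutBy 4 f X → ∃ σ : X ⟶ X, Deck d X hX σ ∧ Comm X hX σ := by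
  intro pmul2 fac shn Deck Cen Comm d hd h4
  classical
  haveI hHTF : HodgeTensorFacts.{0, 0} := hodgeTensorFacts_holds
  -- ### (K) the pointwise kernel on the named family
  have hK := SignSymmetricPowersPencilKernel.signModel_of_identityComponent_le_mumfordTate
    (signDeckHodge_of_genusBound stub_genusBoundThreefold) affineHypersurfaceComplement_meridians_normalClosure_eq_top_holds
    discriminant_localBranches_nodal_holds Literature.AlgebraicGeometry.HodgeTheory.WeightedPencil.symmetricA3NonCommutation_mono_holds
    affineHypersurfaceComplement_meridian_isConj_holds
  obtain ⟨hu, hU, A, hA, hfin, t₀, hK⟩ := hK hd h4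
  haveI : ∀ t : ComplexPoints (baseM ℂ 3 d {m : DegIndex 3 d | Even (m.1 0 + m.1 1)}),
      Module.Finite ℚ (bettiCohomology (fiberOver (familyM ℂ 3 d {m : DegIndex 3 d | Even (m.1 0 + m.1 1)}) t) 3) := hfin
  -- ### (G)+(D) the meagre, coefficient-null exceptional set of points of `S_{M_ι}(ℂ)` (§1, pinned Griffiths)
  obtain ⟨MS, hMS, hMSnull, hΓ⟩ := exists_nullMeagre_identityComponent_le_mumfordTate_familyM (by omega)
    {m : DegIndex 3 d | Even (m.1 0 + m.1 1)} 3 hu hU A hA ⟨t₀⟩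
  -- ### (χ) the coefficient chart and the restricted discriminant
  obtain ⟨Disc, -, -, -, hV⟩ := exists_irreducible_isHomogeneous_discriminantForm (n := 3) (d := d) (by omega)
  let χ : ComplexPoints (baseM ℂ 3 d {m : DegIndex 3 d | Even (m.1 0 + m.1 1)}) →
      ({m : DegIndex 3 d | Even (m.1 0 + m.1 1)} → ℂ) := fun t =>
    (coeffVector ℂ 3 d (AlgPoints.map (toBase ℂ 3 d {m : DegIndex 3 d | Even (m.1 0 + m.1 1)}) t)) ∘
      (Subtype.val : {m : DegIndex 3 d | Even (m.1 0 + m.1 1)} → DegIndex 3 d)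
  have hχemb : IsEmbedding χ := SignSymmetricPowersMeridianChart.isEmbedding_coeffChart 3 d {m : DegIndex 3 d | Even (m.1 0 + m.1 1)}
  have hrange : Set.range χ = {a | MvPolynomial.eval a (killHom ℂ 3 d {m : DegIndex 3 d | Even (m.1 0 + m.1 1)} Disc) ≠ 0} :=
    SignSymmetricPowersMeridianChart.range_coeffChart_eq 3 d {m : DegIndex 3 d | Even (m.1 0 + m.1 1)} hV
  have hχ : ∀ (t : ComplexPoints (baseM ℂ 3 d {m : DegIndex 3 d | Even (m.1 0 + m.1 1)}))
      (m : {m : DegIndex 3 d | Even (m.1 0 + m.1 1)}),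
      χ t m = MvPolynomial.coeff m.1.1 (pointFormM ℂ 3 d _ t) := by
    intro t m
    change coeffVector ℂ 3 d (AlgPoints.map (toBase ℂ 3 d {m : DegIndex 3 d | Even (m.1 0 + m.1 1)}) t) m.1 = _
    rw [coeffVector_apply]
  -- `D_{M_ι} ≠ 0`: it does not vanish at the chart of `t₀`
  have hDM : killHom ℂ 3 d {m : DegIndex 3 d | Even (m.1 0 + m.1 1)} Disc ≠ 0 := by
    intro h0
    have ht₀ : χ t₀ ∈ Set.range χ := ⟨t₀, rfl⟩
    rw [hrange, mem_setOf_eq, h0, map_zero] at ht₀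
    exact ht₀ rfl
  -- ### the meagre exceptional set of coefficient vectors
  refine ⟨χ '' MS ∪ {a | MvPolynomial.eval a (killHom ℂ 3 d {m : DegIndex 3 d | Even (m.1 0 + m.1 1)} Disc) = 0},
    (hχemb.isInducing.isMeagre_image hMS).union (SignSymmetricPowersSignThreefoldPowersHodgeOffMeagre.isMeagre_setOf_eval_eq_zero hDM),
    measure_union_null hMSnull (volume_setOf_eval_eq_zero hDM), ?_⟩
  intro F hF hev hFM X hX hcut
  rw [mem_union, not_or] at hFM
  obtain ⟨hF1, hF2⟩ := hFM
  have hMF : IsSupportedOn 3 d {m : DegIndex 3 d | Even (m.1 0 + m.1 1)} F := isSupportedOn_of_coeff_odd_eq_zero hev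
  -- `F` is a nonsingular form: its coefficient vector lies in the image of the chart
  have hmem : (fun m : {m : DegIndex 3 d | Even (m.1 0 + m.1 1)} => F.coeff m.1.1) ∈ Set.range χ := by
    rw [hrange]
    exact hF2
  have hJ : IsNonsingularForm ℂ F := by
    obtain ⟨t, ht⟩ := hmem
    have hvec : coeffVector ℂ 3 d (AlgPoints.map (toBase ℂ 3 d {m : DegIndex 3 d | Even (m.1 0 + m.1 1)}) t) =
        fun m : DegIndex 3 d => MvPolynomial.coeff m.1 F := by
      funext m
      by_cases hm : m ∈ {m : DegIndex 3 d | Even (m.1 0 + m.1 1)}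
      · exact congrFun ht ⟨m, hm⟩
      · rw [coeffVector_map_toBase_of_not_mem ℂ 3 d {m : DegIndex 3 d | Even (m.1 0 + m.1 1)} t hm]
        exact (hev m.1 hm).symm
    have hform : pointForm ℂ 3 d (AlgPoints.map (toBase ℂ 3 d {m : DegIndex 3 d | Even (m.1 0 + m.1 1)}) t) = F := by
      rw [← formOfCoeffs_coeffVector, hvec]
      exact formOfCoeffs_coeff F hF
    have h := isNonsingularForm_pointForm ℂ 3 d (AlgPoints.map (toBase ℂ 3 d {m : DegIndex 3 d | Even (m.1 0 + m.1 1)}) t)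
    rwa [hform] at h
  obtain ⟨eX⟩ := hcut.nonempty_iso_hypersurface
  have hXF : IsSmoothProjective 3 (SmoothHypersurface.hypersurface F) := hX.of_iso eX
  have ha := signUnits_two_mem_diagonalStabilizer F hev
  -- the classifying point of `F` lies off `MS`: its chart is the coefficient vector of `F`
  have hpt : χ (classifyingPoint ℂ 3 d {m : DegIndex 3 d | Even (m.1 0 + m.1 1)} t₀ F) =
      fun m : {m : DegIndex 3 d | Even (m.1 0 + m.1 1)} => F.coeff m.1.1 := by
    funext m
    rw [hχ, classifyingPoint_eq ℂ 3 d _ t₀ hF hJ hMF, pointFormM_pointOfFormM]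
  have hoff : classifyingPoint ℂ 3 d {m : DegIndex 3 d | Even (m.1 0 + m.1 1)} t₀ F ∉ MS :=
    fun hin => hF1 ⟨_, hin, hpt⟩
  -- ### (K) at the classifying point
  obtain ⟨⟨h1, h2, h3⟩, hComm⟩ := hK F hF hev hJ hXF ha (hΓ _ hoff)
  -- ### (MT) model transfer to `X` along `X ≅ X_F`
  exact ⟨eX.hom ≫ diagonalAut _ ha ≫ eX.inv, ⟨pull_conj_sq_eq_one_of_iso eX h1, tr_cup_pull_conj_of_iso hX hXF eX h2,
      fun j q hj hq => by
        rw [finrank_eigenspace_inf_piece_eq_of_iso exists_isReal_hodgeModel_holds hodgePQ_independent_of_hodgeModel_holds hX hXF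
          eX (diagonalAut _ ha) 3]
        exact h3 j q hj hq⟩,
    comm_of_iso exists_isReal_hodgeModel_holds hodgePQ_independent_of_hodgeModel_holds hX hXF eX (diagonalAut _ ha) 3 hComm⟩

/-! ### §3 The analytic leaf — almost everywhere, unconditional -/

/-- **The rung-F-H1 leaf ALMOST EVERYWHERE, UNCONDITIONALLY: the Hodge conjecture holds on ALL self fibre powers of every smooth threefold
`X ⊂ ℙ⁴` cut out by an ι-even form of even degree `d ≥ 4` whose coefficient vector lies off ONE subset of `ℂ^{M_ι}` that is MEAGRE AND
LEBESGUE-NULL.**  For every even `d ≥ 4` there is `M ⊆ ℂ^{M_ι}` with `IsMeagre M ∧ volume M = 0` such that for every ι-even homogeneous `F` of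
degree `d` with `M_ι`-coefficient vector off `M`, every smooth projective `X` cut out in `ℙ⁴` by `F` and every `(k+1)`-fold self fibre power
`Y` of `X`: `HodgeConjectureFor (3(k+1)) Y` (§2 + K2-B `SignSymmetricPowersClose.powersHodgeOfSignCommutators`).  NO hypothesis, axioms standard.
HONEST FRAMING: the Hodge conjecture for all powers of Lebesgue-almost-every (and comeagre-many) ι-even threefold of every even degree `d ≥ 4`;
the exceptional set is NOT shown to lie in a countable union of proper Zariski-closed subsets (Cattani–Deligne–Kaplan, print input 23152), so
items 19716 ∕ 19715 stay OPEN; rung F-H1 is not moved by this file; nothing here says HC ∕ HC_CM ∕ HC_AV is proved.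
[cite: Deligne1972WeilK3, Prop. 7.5] [cite: Andre1992, §4 Lemma 4 and §5 Thm. 1] [cite: VoisinHodgeII2003, §5.3.1 Lemma 5.13 and §6.2.1]
[cite: Griffiths1968PeriodsII, Thm. 1.1] [cite: Mityagin2015, Proposition 1] -/
theorem signThreefoldPowersHodge_ae :
    ∀ ⦃d : ℕ⦄, Even d → 4 ≤ d →
      ∃ Mb : Set ({m : DegIndex 3 d | Even (m.1 0 + m.1 1)} → ℂ), IsMeagre Mb ∧ MeasureTheory.volume Mb = 0 ∧
        ∀ F : MvPolynomial (Fin 5) ℂ, F.IsHomogeneous d → (∀ e : Fin 5 →₀ ℕ, ¬ Even (e 0 + e 1) → F.coeff e = 0) →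
          (fun m : {m : DegIndex 3 d | Even (m.1 0 + m.1 1)} => F.coeff m.1.1) ∉ Mb →
          ∀ ⦃X : SchemeOver ℂ⦄, IsSmoothProjective 3 X → IsHypersurfaceCutOutBy 4 F X →
            ∀ ⦃k : ℕ⦄ ⦃Y : SchemeOver ℂ⦄, (∃ π : Fin (k + 1) → (Y ⟶ X), Nonempty (IsLimit (Fan.mk Y π))) →
              HodgeConjectureFor (3 * (k + 1)) Y := by
  intro d hd h4
  obtain ⟨Mb, hMb, hMb0, h⟩ := exists_signDeck_comm_ae hd h4
  exact ⟨Mb, hMb, hMb0, fun F hF hev hFM X hX hcut k Y hY =>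
    SignSymmetricPowersClose.powersHodgeOfSignCommutators hd h4 hX ⟨F, hF, hev, hcut⟩ (h F hF hev hFM hX hcut) hY⟩

/-- **The good set has full measure and is comeagre** (consumer remark): for every even `d ≥ 4`, Lebesgue-almost-every ι-even
coefficient vector `a ∈ ℂ^{M_ι}` lies off the exceptional set of `signThreefoldPowersHodge_ae`. [folklore] -/
theorem ae_not_mem_exceptional {d : ℕ} {Mb : Set ({m : DegIndex 3 d | Even (m.1 0 + m.1 1)} → ℂ)}
    (hMb0 : MeasureTheory.volume Mb = 0) : ∀ᵐ a ∂MeasureTheory.volume, a ∉ Mb := by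
  rw [MeasureTheory.ae_iff]
  simpa only [not_not, Set.setOf_mem_eq] using hMb0

end Summit.HodgeConjecture.HodgeConjecture.Theorems.SignSymmetricPowersSignThreefoldPowersHodgeAlmostAll
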